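import Mathlib
import Summits.ValiantsHypothesis.ValiantsHypothesis.Theorems.KPlusLogSqLawWeakLiftingTowerGraftOperatorRouche

/-!
# Tower graft line — a CHECKABLE sufficient condition for the matrix-level Rouché count: ROW-DOMINANCE MARGIN (Gershgorin)

Sequel to `…TowerGraftOperatorRouche.lean` (same seat; LINE (B) `Cruxes/WeakLifting/Lines/tower_graft.lean`, crux `WeakLifting` =
stmt-ValiantsHypothesis-19561; T1 instrument tier).  NO stub is claimed.

The matrix-level Rouché count `card_roots_det_add_eq_of_homotopy` asks that `det (F₀(τ) + l·Q(τ)) ≠ 0` for every `l ∈ [0,1]` and every `τ` on the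
circle.  A norm-free, entrywise CHECKABLE sufficient condition (§1, `det_add_smul_ne_zero_of_rowMargin`): the ROW-DOMINANCE MARGIN
`Σ_{j ≠ k} (‖F₀ k j‖ + ‖Q k j‖) + ‖Q k k‖ < ‖F₀ k k‖` for every row `k` — then every `F₀ + l·Q`, `0 ≤ l ≤ 1`, is strictly row-diagonally dominant
and Gershgorin (Mathlib `det_ne_zero_of_sum_row_lt_diag`) gives `det ≠ 0`.  Hence (§2, `card_roots_det_add_eq_of_rowMargin`): if the margin holds at
every point of the circle `|τ − c| = R`, then `det (F₀ + Q)` and `det F₀` have equally many roots in the disc; and the real-graft form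
`card_posRoots_det_add_le_sum_discs_of_rowMargin` (discs with the margin on their circles, covering the positive roots) bounds
`Z₊(det (F₀ + Q))` by the roots of the BASE determinant `det F₀` in the discs.  For a tower graft `F₀ = G`, `Q = X^D·S` the margin on a circle of
radius `ρt₀` around an axis point `t₀ < 1` reads «the diagonal entry of `G` dominates its row and `|τ|^D·‖S‖` there» — the base-dominant zone.
HONEST FRAMING: elementary (triangle inequality + Gershgorin); an instrument, no law; nothing on S4/S4b/S5, TowerB, `WeakLifting`, B, 18050 or
VP ≠ VNP.  Def-free.  Seat: prover val-sym-lift-p2 g22, `--supports stmt-ValiantsHypothesis-19561 --as helper`.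
-/

-- `Summit.ValiantsHypothesis.ValiantsHypothesis.…` repeats a component by the D-0017 layout
-- (single-conjunct summit), which the `dupNamespace` linter flags; the name is mandated.
set_option linter.dupNamespace false

namespace Summit.ValiantsHypothesis.ValiantsHypothesis.Theorems.KPlusLogSqLaw.TowerGraft

open Polynomial Complex
open scoped BigOperators Polynomial

/-! ## §1 Row-dominance margin ⇒ the whole homotopy is non-singular -/

section Margin

variable {n : Type*} [Fintype n] [DecidableEq n]

/-- **ROW-DOMINANCE MARGIN.**  If `Σ_{j ≠ k} (‖A k j‖ + ‖B k j‖) + ‖B k k‖ < ‖A k k‖` for every row `k` (complex matrices), then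
`det (A + l·B) ≠ 0` for every real `l` with `|l| ≤ 1` — each `A + l·B` is strictly row-diagonally dominant (Gershgorin). [folklore] -/
theorem det_add_smul_ne_zero_of_rowMargin (A B : Matrix n n ℂ)
    (h : ∀ k, (∑ j ∈ Finset.univ.erase k, (‖A k j‖ + ‖B k j‖)) + ‖B k k‖ < ‖A k k‖) {l : ℝ} (hl : |l| ≤ 1) :
    (A + (l : ℂ) • B).det ≠ 0 := by
  refine det_ne_zero_of_sum_row_lt_diag fun k => ?_
  have hlB : ∀ i j, ‖(l : ℂ) * B i j‖ ≤ ‖B i j‖ := by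
    intro i j
    rw [norm_mul, Complex.norm_real, Real.norm_eq_abs]
    calc |l| * ‖B i j‖ ≤ 1 * ‖B i j‖ := mul_le_mul_of_nonneg_right hl (norm_nonneg _)
      _ = ‖B i j‖ := one_mul _
  -- off-diagonal row sum of `A + lB` ≤ Σ (‖A‖ + ‖B‖)
  have hoff : (∑ j ∈ Finset.univ.erase k, ‖(A + (l : ℂ) • B) k j‖) ≤ ∑ j ∈ Finset.univ.erase k, (‖A k j‖ + ‖B k j‖) := by
    refine Finset.sum_le_sum fun j _ => ?_
    rw [Matrix.add_apply, Matrix.smul_apply, smul_eq_mul]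
    exact (norm_add_le _ _).trans (by linarith [hlB k j])
  -- diagonal of `A + lB` ≥ ‖A k k‖ − ‖B k k‖
  have hdiag : ‖A k k‖ - ‖B k k‖ ≤ ‖(A + (l : ℂ) • B) k k‖ := by
    rw [Matrix.add_apply, Matrix.smul_apply, smul_eq_mul]
    have h1 : ‖A k k‖ ≤ ‖A k k + (l : ℂ) * B k k‖ + ‖(l : ℂ) * B k k‖ := by
      have := norm_add_le (A k k + (l : ℂ) * B k k) (-((l : ℂ) * B k k))
      rwa [add_neg_cancel_right, norm_neg] at this
    linarith [hlB k k]
  linarith [h k]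

/-- the margin at a point of the circle for matrix POLYNOMIALS evaluated there gives the homotopy hypothesis of the matrix-level Rouché count.
[this work] -/
theorem eval_det_homotopy_ne_zero_of_rowMargin (F₀ Q : Matrix n n ℂ[X]) (τ : ℂ)
    (h : ∀ k, (∑ j ∈ Finset.univ.erase k, (‖(F₀ k j).eval τ‖ + ‖(Q k j).eval τ‖)) + ‖(Q k k).eval τ‖ < ‖(F₀ k k).eval τ‖)
    {l : ℝ} (hl0 : 0 ≤ l) (hl1 : l ≤ 1) :
    ((F₀ + C (l : ℂ) • Q).det).eval τ ≠ 0 := by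
  have hev : ((F₀ + C (l : ℂ) • Q).det).eval τ = (F₀.map (Polynomial.eval τ) + (l : ℂ) • Q.map (Polynomial.eval τ)).det := by
    rw [← Polynomial.coe_evalRingHom, RingHom.map_det, RingHom.mapMatrix_apply]
    congr 1
    ext i j
    simp [Matrix.map_apply, Matrix.add_apply, Matrix.smul_apply]
  rw [hev]
  refine det_add_smul_ne_zero_of_rowMargin _ _ (fun k => ?_) (abs_le.mpr ⟨by linarith, hl1⟩)
  simpa [Matrix.map_apply] using h k

end Margin

/-! ## §2 The Rouché counts under the margin -/

section Counts

variable {n : Type*} [Fintype n] [DecidableEq n]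

/-- **MATRIX-LEVEL ROUCHÉ UNDER THE ROW MARGIN.**  If the row-dominance margin of `F₀` over `Q` holds at every point of the circle `|τ − c| = R`
(`R > 0`), then `det (F₀ + Q)` and `det F₀` have the same number of roots (with multiplicity) in the open disc. [this work] -/
theorem card_roots_det_add_eq_of_rowMargin (F₀ Q : Matrix n n ℂ[X]) (c : ℂ) {R : ℝ} (hR : 0 < R)
    (h : ∀ τ ∈ Metric.sphere c R, ∀ k,
      (∑ j ∈ Finset.univ.erase k, (‖(F₀ k j).eval τ‖ + ‖(Q k j).eval τ‖)) + ‖(Q k k).eval τ‖ < ‖(F₀ k k).eval τ‖) :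
    Multiset.card ((F₀ + Q).det.roots.filter fun z => dist z c < R) =
      Multiset.card (F₀.det.roots.filter fun z => dist z c < R) :=
  card_roots_det_add_eq_of_homotopy F₀ Q c hR fun _ hl0 hl1 τ hτ =>
    eval_det_homotopy_ne_zero_of_rowMargin F₀ Q τ (h τ hτ) hl0 hl1

/-- **REAL-GRAFT FORM UNDER THE ROW MARGIN.**  Real matrix polynomials `F₀`, `Q`; discs `B(ctr i, rad i)` on whose circles the complexified margin
holds and which cover every positive root of `det (F₀ + Q)`: then `Z₊(det (F₀ + Q)) ≤ Σᵢ #{roots of det F₀ in disc i}`. [this work] -/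
theorem card_posRoots_det_add_le_sum_discs_of_rowMargin (F₀ Q : Matrix n n ℝ[X]) {ι : Type*} (I : Finset ι) (ctr : ι → ℂ) (rad : ι → ℝ)
    (hrad : ∀ i ∈ I, 0 < rad i)
    (h : ∀ i ∈ I, ∀ τ ∈ Metric.sphere (ctr i) (rad i), ∀ k,
      (∑ j ∈ Finset.univ.erase k, (‖((F₀ k j).map Complex.ofRealHom).eval τ‖ + ‖((Q k j).map Complex.ofRealHom).eval τ‖)) +
        ‖((Q k k).map Complex.ofRealHom).eval τ‖ < ‖((F₀ k k).map Complex.ofRealHom).eval τ‖)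
    (hcov : ∀ t : ℝ, 0 < t → ((F₀ + Q).det).eval t = 0 → ∃ i ∈ I, dist (t : ℂ) (ctr i) < rad i) :
    (((F₀ + Q).det).roots.toFinset.filter (fun t => 0 < t)).card ≤
      ∑ i ∈ I, Multiset.card (((F₀.det).map Complex.ofRealHom).roots.filter fun z => dist z (ctr i) < rad i) := by
  refine card_posRoots_det_add_le_sum_discs F₀ Q I ctr rad hrad (fun i hi _ hl0 hl1 τ hτ => ?_) hcov
  refine eval_det_homotopy_ne_zero_of_rowMargin _ _ τ (fun k => ?_) hl0 hl1
  simpa [Matrix.map_apply] using h i hi τ hτ k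

end Counts

end Summit.ValiantsHypothesis.ValiantsHypothesis.Theorems.KPlusLogSqLaw.TowerGraft
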